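import Mathlib.MeasureTheory.Integral.Prod
import Mathlib.MeasureTheory.Integral.IntervalIntegral.Basic
import Mathlib.MeasureTheory.Function.SpecialFunctions.Basic
import HarnessLib

/-!
# The stationary kinetic slab problem with albedo (grey) walls and its conductance

Topic: MathematicalPhysics / KineticTheory (linear transport in slab geometry; phonon Boltzmann
equation between two thermostats).

A *kinetic medium* on a momentum space `K` (for the phonon problem `K = 𝕋 = ℝ/2πℤ`) is the data
`M = (μ, v, C, dom, refl, e, w)`: the reference measure `dk`, the group velocity `v(k)` normal to
the walls, a collision operator `C` acting on momentum profiles `f : K → ℝ` with domain `dom`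
(solutions are sought with slices in `dom`), the specular reflection
`refl : K → K` of momenta at a wall (`k ↦ -k`), the equilibrium profile `e(k)` per unit
temperature (the linearised Rayleigh–Jeans/Planck law: the equilibrium at temperature `θ` is
`W ≡ θ • e`) and the energy `w(k)` carried by mode `k` per unit of `W` (so the energy flux of a
phase–space profile `W(y, k)` through the plane `y` is `J(y) = ∫ v(k) w(k) W(y,k) dk`).

Given wall albedos (emissivity = absorptivity, Kirchhoff) `αL, αR : K → [0,1]`, a kinetic length
`L > 0` and wall temperatures `θL, θR`, the STATIONARY KINETIC SLAB PROBLEM is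

  `v(k) ∂_y W(y,k) = (C W(y,·))(k)`                    on `(0, L) × K`,
  `W(0,k) = θL αL(k) e(k) + (1 - αL(k)) W(0, refl k)`   for `v(k) > 0`  (left wall, inflow),
  `W(L,k) = θR αR(k) e(k) + (1 - αR(k)) W(L, refl k)`   for `v(k) < 0`  (right wall, inflow):

a phonon hitting a wall is absorbed with probability `α(k)` and specularly reflected otherwise,
and the wall emits into mode `k` at its own temperature with emissivity `α(k)` — the END-SITE
version (no transmission, `p₊ = 0`, `p₋ = 1 - 𝔤`, `𝔤 = α`) of the Komorowski–Olla thermostat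
interface law `W(0⁺,k) = p₋(k) W(0⁺,-k) + p₊(k) W(0⁻,k) + 𝔤(k) T` [KomorowskiOlla2020, §1 (interface
conditions) and §2.6.1 Def. 2.2; KomorowskiOlla2021, §3.4 and §6.2 "More thermostats"], i.e.
Maxwell's accommodation law
"(1 - α) × specular + α × thermal emission at the wall temperature" [Cercignani1988, Ch. III §5
(5.1)] for a linear(ised) kinetic equation; heat transfer between parallel plates at different
temperatures as a function of the inverse Knudsen number is the classical slab problem of kinetic
theory [Cercignani1988, Ch. VII §5; BardosSantosSentis1984].

* `KineticMedium.IsSlabSolution M αL αR L θL θR W` — `W : ℝ → K → ℝ` is a finite-energy MILD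
  solution: `W(y,·) ∈ dom` for `y ∈ [0,L]`; for `μ`-a.e. mode `k`, `y ↦ (C W(y,·))(k)` is
  integrable on `[0,L]` and
  `v(k) (W(y,k) - W(0,k)) = ∫₀ʸ (C W(s,·))(k) ds` for `y ∈ [0,L]` (the equation integrated along
  the characteristic; for `v(k) = 0` it says `C W(·,k) = 0` a.e.), the two wall laws hold
  `μ`-a.e. on `{v > 0}` resp. `{v < 0}`, the energy flux integrand `v w W(y,·)` is integrable for
  every `y ∈ [0,L]`, and the energy exchange rate `w(k) (C W(y,·))(k)` is integrable on
  `[0,L] × K`.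
* `KineticMedium.energyFlux M W y = ∫ v w W(y,·) dμ`.
* `KineticSlabConductance M αL αR L G` (the requested notion, RELATIONAL as asked, since no
  well-posedness theorem is vendored with it): every finite-energy mild solution with wall
  temperatures `θL, θR` carries the `y`-independent energy flux `G (θL - θR)` at every height
  `y ∈ [0,L]`.
* `KineticMedium.slabConductance M αL αR L : ℝ` — the number `G` when it is uniquely determined
  (junk value `0` otherwise), with `kineticSlabConductance_slabConductance`.

* `twoStreamMedium` — worked special case (collisionless forward/backward streams between grey
  walls): a solution exists in closed form and EVERY solution has flux
  `(θL - θR)/(1/αL + 1/αR - 1)` (`twoStreamMedium.kineticSlabConductance`), the exchange factor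
  of two parallel grey planes, `α/(2-α)` for equal albedos — a check of signs and normalisations.

API (all proved): the flux of a solution is constant in `y` when `C` conserves `w`-energy on it
(`IsSlabSolution.energyFlux_eq_energyFlux_zero`); the equilibrium `W ≡ θ • e` is a solution with
equal wall temperatures when `C(θ • e) = 0` and `e ∘ refl = e` (`isSlabSolution_equilibrium`), with
flux `θ ∫ v w e` (`energyFlux_equilibrium`); superposition for `C` linear on a subspace `dom`
(`IsSlabSolution.add`, `IsSlabSolution.smul`) and the resulting REDUCTION
(`kineticSlabConductance_of_homogeneous`): `G` is the conductance as soon as homogeneous (cold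
wall) solutions carry no flux and one solution of the unit problem carries flux `G`; uniqueness
of `G` as soon as one solution with `θL ≠ θR` exists (`KineticSlabConductance.unique`) and the
bridge to `slabConductance`.

Design choices. (1) `K` is general (Mathlib generality: `K = [-1,1]` or `S²` with `v(k) = k₁` is
one-speed neutron transport / radiative transfer between grey plates, `K = ℝ³` a linearised gas,
`K = 𝕋` phonons); the phonon slab of route KineticSlabContacts takes `K = ℝ` with
`μ = (2π)⁻¹ • volume.restrict (Ioc (-π) π)` (or `AddCircle (2π)`), `v k = sin k / ω k`,
`refl = Neg.neg`, and either the NUMBER normalisation `e = 1/ω`, `w = ω` (Wigner function) or the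
ENERGY normalisation `e = 1`, `w = 1` of Komorowski–Olla; in both `w • e = 1`. (2) `C` is a bare
map `(K → ℝ) → (K → ℝ)` together with a domain `dom : Set (K → ℝ)`: stating the boundary-value
problem needs no linearity, and an integral collision operator with unbounded collision frequency
(a closed operator on a weighted `L²(𝕋)`) is defined and linear only on its domain; solutions are
required to have their slices in `dom`, so the larger `dom`, the stronger the conductance
statement; lemmas that need linearity take it as a hypothesis. (3) Everything in `k` is
`μ`-a.e. (weak/`L²` theories produce `W(y,·)` up to null sets); everything in `y` is pointwise
on `[0,L]` through the mild formulation, so traces at the walls are honest values. (4) No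
existence or uniqueness is claimed: those are the content of the slab theory (coercivity of
`-C`, positivity of the albedos) and are left to the items that use this notion (see the
reduction `kineticSlabConductance_of_homogeneous`); if no solution with `θL ≠ θR` exists the
relational predicate holds for every `G` (documented vacuity), and `slabConductance` is then `0`.
(5) In the collisionless case `C = 0` with `v ∘ refl = -v`, `w, e` even and `μ` reflection
invariant, solving the two wall laws for the pair `(k, refl k)` gives the two-grey-wall Landauer
value `G = ∫_{v>0} v w e · αL αR∘refl / (αL + αR∘refl - αL αR∘refl) dμ`, `= ∫_{v>0} v w e α/(2-α)`
for equal even albedos — the integrand `v α/(2 - α)` of item LandauerAlbedoIdentity of that route;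
vendored here only in its two-stream skeleton (`twoStreamMedium.kineticSlabConductance`).

## References

* T. Komorowski, S. Olla, *Kinetic limit for a chain of harmonic oscillators with a point Langevin
  thermostat*, J. Funct. Anal. 279 (2020) 108764 (arXiv:1910.00342), §1 (interface conditions
  at `y = 0`: transmission `p₊`, reflection `p₋`, absorption/creation `𝔤`, `p₊ + p₋ + 𝔤 = 1`),
  §2.6.1 Definition 2.2.
* T. Komorowski, S. Olla, *Thermal boundaries in kinetic and hydrodynamic limits*, in: Recent
  Advances in Kinetic Equations and Applications, Springer INdAM 48 (2021) (arXiv:2010.04721),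
  §1, §3.4 (boundary condition at the thermostat), §6.2 (more thermostats: one boundary condition
  per thermostat, with its own temperature — stated there as an expected extension).
* C. Cercignani, *The Boltzmann Equation and Its Applications*, Springer (1988), Ch. III §5
  (Maxwell's boundary conditions, eq. (5.1)); Ch. VII §5 (heat transfer between parallel plates).
* C. Bardos, R. Santos, R. Sentis, *Diffusion approximation and computation of the critical
  size*, Trans. AMS 284 (1984) 617–649 (slab transport, diffusion approximation, Milne layers).
* G. Basile, T. Komorowski, S. Olla, *Diffusion limit for a kinetic equation with a thermostatted
  interface*, Kinet. Relat. Models 12 (2019).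
* I. Granet, J. L. Alvarado, M. Bluestein, *Thermodynamics and Heat Power*, CRC (2020),
  Table 11.4 (Hottel's factors): infinite parallel planes `F_e = 1/(1/ε₁ + 1/ε₂ - 1)`.
-/

noncomputable section

open MeasureTheory Set Filter
open scoped Topology

namespace Literature.MathematicalPhysics.KineticTheory

/-- A **kinetic medium** on the momentum space `K`: reference measure `μ = dk`, group velocity
`v` normal to the walls, collision operator `C` on momentum profiles, specular reflection `refl`
of momenta at a wall, equilibrium profile `e` per unit temperature (equilibrium at temperature `θ`
is `θ • e`) and energy weight `w` (energy flux of `W(y,·)` is `∫ v w W(y,·) dμ`). For the phonon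
Boltzmann equation of a chain: `K = 𝕋`, `v = ω'/2π`, `refl k = -k`, `C` the (linearised)
collision operator, `e = w = 1` in the energy-density normalisation of the Wigner function.
[cite: KomorowskiOlla2020, §1 and §2.6.1 Definition 2.2] -/
structure KineticMedium (K : Type*) [MeasurableSpace K] where
  /-- the reference measure `dk` on momentum space -/
  μ : Measure K
  /-- group velocity normal to the walls -/
  v : K → ℝ
  /-- collision operator acting on momentum profiles `K → ℝ` (no linearity is imposed here;
  outside `dom` its values are irrelevant) -/
  C : (K → ℝ) → (K → ℝ)
  /-- the domain of `C`: the class of momentum profiles on which `C` is meant and in which the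
  slices `W(y,·)` of solutions are sought (e.g. a weighted `L²` space making `-C` symmetric
  non-negative; `Set.univ` for a bounded `C`) -/
  dom : Set (K → ℝ)
  /-- specular reflection of momenta at a wall (`k ↦ -k`) -/
  refl : K → K
  /-- equilibrium profile per unit temperature: a wall at temperature `θ` emits `θ • e` -/
  e : K → ℝ
  /-- energy carried by mode `k` per unit of `W` (`ω` if `W` is a number density, `1` if `W` is
  an energy density) -/
  w : K → ℝ

namespace KineticMedium

variable {K : Type*} [MeasurableSpace K] (M : KineticMedium K)

/-- The **energy flux** through the plane at height `y` of a phase-space profile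
`W : ℝ → K → ℝ`: `J(y) = ∫ v(k) w(k) W(y,k) dμ(k)`. [folklore] -/
def energyFlux (W : ℝ → K → ℝ) (y : ℝ) : ℝ :=
  ∫ k, M.v k * M.w k * W y k ∂M.μ

/-- `M.IsSlabSolution αL αR L θL θR W`: `W : ℝ → K → ℝ` (height `y`, mode `k`) is a
**finite-energy mild solution of the stationary kinetic slab problem** of kinetic length `L` with
albedo walls `αL` (at `y = 0`, temperature `θL`) and `αR` (at `y = L`, temperature `θR`):
slices `W(y,·) ∈ dom`, `v ∂_y W = C W` on `(0,L) × K` integrated along characteristics for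
`μ`-a.e. mode, the inflow
laws `W(0,k) = θL αL(k) e(k) + (1 - αL(k)) W(0, refl k)` for `v(k) > 0` and
`W(L,k) = θR αR(k) e(k) + (1 - αR(k)) W(L, refl k)` for `v(k) < 0` (absorption with probability
`α`, specular reflection otherwise, thermal emission with emissivity `α`: the end-site case
`p₊ = 0` of the Komorowski–Olla interface condition, Maxwell's accommodation law), and
integrability of the energy flux integrand and of the energy exchange rate.
[cite: KomorowskiOlla2020, §1 (interface conditions) and §2.6.1 Definition 2.2] -/
structure IsSlabSolution (αL αR : K → ℝ) (L θL θR : ℝ) (W : ℝ → K → ℝ) : Prop where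
  /-- every slice `W(y,·)`, `y ∈ [0,L]`, lies in the domain of the collision operator -/
  mem_dom : ∀ y ∈ Icc 0 L, W y ∈ M.dom
  /-- for a.e. mode the collision term is integrable along the characteristic -/
  collision_integrableOn : ∀ᵐ k ∂M.μ, IntegrableOn (fun y => M.C (W y) k) (Icc 0 L)
  /-- the transport equation `v ∂_y W = C W`, mild form, for a.e. mode -/
  transport : ∀ᵐ k ∂M.μ, ∀ y ∈ Icc 0 L,
    M.v k * (W y k - W 0 k) = ∫ s in (0 : ℝ)..y, M.C (W s) k
  /-- inflow law at the left wall `y = 0` (modes moving right) -/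
  left_wall : ∀ᵐ k ∂M.μ, 0 < M.v k →
    W 0 k = θL * αL k * M.e k + (1 - αL k) * W 0 (M.refl k)
  /-- inflow law at the right wall `y = L` (modes moving left) -/
  right_wall : ∀ᵐ k ∂M.μ, M.v k < 0 →
    W L k = θR * αR k * M.e k + (1 - αR k) * W L (M.refl k)
  /-- the energy flux integrand is integrable at every height -/
  flux_integrable : ∀ y ∈ Icc 0 L, Integrable (fun k => M.v k * M.w k * W y k) M.μ
  /-- the energy exchange rate `w · C W` is integrable on `[0,L] × K` -/
  exchange_integrable :
    Integrable (fun p : ℝ × K => M.w p.2 * M.C (W p.1) p.2) ((volume.restrict (Icc 0 L)).prod M.μ)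

end KineticMedium

variable {K : Type*} [MeasurableSpace K]

/-- **Kinetic slab conductance** (relational form). `KineticSlabConductance M αL αR L G`: `G` is
the conductance of the stationary kinetic slab of kinetic length `L` with albedo walls `αL, αR` in
the medium `M` — every finite-energy mild solution `W` with wall temperatures `θL, θR`
(`M.IsSlabSolution αL αR L θL θR W`) carries, at every height `y ∈ [0,L]`, the energy flux
`∫ v w W(y,·) dμ = G · (θL - θR)` (heat flux between two parallel plates per unit temperature
difference, as a function of the plate distance in mean free paths). Relational because no
well-posedness theorem is vendored here: `G` is unique as soon as one solution with `θL ≠ θR`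
exists (`KineticSlabConductance.unique`), and vacuous if none does.
[cite: Cercignani1988, Ch. VII §5 (heat transfer between parallel plates) and Ch. III §5 (5.1)] -/
def KineticSlabConductance (M : KineticMedium K) (αL αR : K → ℝ) (L G : ℝ) : Prop :=
  ∀ ⦃θL θR : ℝ⦄ ⦃W : ℝ → K → ℝ⦄, M.IsSlabSolution αL αR L θL θR W →
    ∀ y ∈ Icc 0 L, M.energyFlux W y = G * (θL - θR)

namespace KineticMedium

variable (M : KineticMedium K) {αL αR : K → ℝ} {L θL θR : ℝ} {W : ℝ → K → ℝ}

/-- The **slab conductance as a number**: the unique `G` with `KineticSlabConductance M αL αR L G`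
when such a `G` is unique, and the junk value `0` otherwise (no solution with `θL ≠ θR`, or
inconsistent fluxes); see `kineticSlabConductance_slabConductance`. [folklore] -/
def slabConductance (αL αR : K → ℝ) (L : ℝ) : ℝ := by
  classical
  exact if h : ∃! G : ℝ, KineticSlabConductance M αL αR L G then h.choose else 0

/-! ### The energy flux of a solution is constant in `y` -/

/-- **Constancy of the energy flux.** If `W` is a finite-energy mild solution and the collision
operator conserves `w`-energy on its profiles (`∫ w · C W(s,·) dμ = 0` for `s ∈ [0,L]`; for the
phonon Boltzmann operator this is energy conservation), then `J(y) = J(0)` for every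
`y ∈ [0,L]`: `J(y) - J(0) = ∫ w v (W(y) - W(0)) = ∫ w ∫₀ʸ C W = ∫₀ʸ ∫ w C W = 0` (Fubini).
[folklore] -/
theorem IsSlabSolution.energyFlux_eq_energyFlux_zero [SFinite M.μ]
    (h : M.IsSlabSolution αL αR L θL θR W)
    (hcons : ∀ s ∈ Icc 0 L, ∫ k, M.w k * M.C (W s) k ∂M.μ = 0) {y : ℝ} (hy : y ∈ Icc 0 L) :
    M.energyFlux W y = M.energyFlux W 0 := by
  have h0 : (0 : ℝ) ∈ Icc 0 L := ⟨le_rfl, hy.1.trans hy.2⟩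
  -- the difference of the two fluxes
  have hdiff : M.energyFlux W y - M.energyFlux W 0 =
      ∫ k, M.w k * (M.v k * (W y k - W 0 k)) ∂M.μ := by
    unfold energyFlux
    rw [← integral_sub (h.flux_integrable y hy) (h.flux_integrable 0 h0)]
    congr 1
    ext k
    ring
  -- insert the mild equation
  have h2 : ∫ k, M.w k * (M.v k * (W y k - W 0 k)) ∂M.μ =
      ∫ k, M.w k * (∫ s in Ioc 0 y, M.C (W s) k) ∂M.μ := by
    apply integral_congr_ae
    filter_upwards [h.transport] with k hk
    rw [hk y hy, intervalIntegral.integral_of_le hy.1]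
  -- Fubini on `Ioc 0 y × K`
  have hint : Integrable (fun p : ℝ × K => M.w p.2 * M.C (W p.1) p.2)
      ((volume.restrict (Ioc 0 y)).prod M.μ) :=
    h.exchange_integrable.mono_measure
      (Measure.prod_mono (Measure.restrict_mono (Ioc_subset_Icc_self.trans (Icc_subset_Icc
        le_rfl hy.2)) le_rfl) le_rfl)
  have h3 : ∫ k, M.w k * (∫ s in Ioc 0 y, M.C (W s) k) ∂M.μ =
      ∫ s in Ioc 0 y, ∫ k, M.w k * M.C (W s) k ∂M.μ := by
    have hswap := integral_integral_swap (f := fun s k => M.w k * M.C (W s) k) hint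
    -- `hswap : ∫ s, ∫ k, f s k = ∫ k, ∫ s, f s k`
    rw [hswap]
    congr 1
    ext k
    rw [← integral_const_mul]
  have h4 : ∫ s in Ioc 0 y, ∫ k, M.w k * M.C (W s) k ∂M.μ = 0 := by
    apply setIntegral_eq_zero_of_forall_eq_zero
    intro s hs
    exact hcons s ⟨hs.1.le, hs.2.trans hy.2⟩
  have : M.energyFlux W y - M.energyFlux W 0 = 0 := by rw [hdiff, h2, h3, h4]
  linarith

/-- Under energy conservation a `KineticSlabConductance` statement only needs the flux at the
left wall. [folklore] -/
theorem kineticSlabConductance_of_wall_flux [SFinite M.μ] {G : ℝ}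
    (hcons : ∀ ⦃θL θR : ℝ⦄ ⦃W : ℝ → K → ℝ⦄, M.IsSlabSolution αL αR L θL θR W →
      ∀ s ∈ Icc 0 L, ∫ k, M.w k * M.C (W s) k ∂M.μ = 0)
    (hwall : ∀ ⦃θL θR : ℝ⦄ ⦃W : ℝ → K → ℝ⦄, M.IsSlabSolution αL αR L θL θR W →
      M.energyFlux W 0 = G * (θL - θR)) :
    KineticSlabConductance M αL αR L G := by
  intro θL θR W hW y hy
  rw [hW.energyFlux_eq_energyFlux_zero M (hcons hW) hy, hwall hW]

/-! ### Equilibrium -/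

/-- The energy flux of the equilibrium profile `W ≡ θ • e` is `θ ∫ v w e dμ` (hence `0` when the
velocity is odd and `w, e, μ` are even under the reflection). [folklore] -/
theorem energyFlux_equilibrium (θ y : ℝ) :
    M.energyFlux (fun _ k => θ * M.e k) y = θ * ∫ k, M.v k * M.w k * M.e k ∂M.μ := by
  unfold energyFlux
  rw [← integral_const_mul]
  congr 1
  ext k
  ring

/-- **Thermal equilibrium solves the slab problem with equal wall temperatures.** If the
equilibrium profile is annihilated by the collision operator (`C (θ • e) = 0` a.e.), is
reflection invariant (`e ∘ refl = e` a.e.) and has an integrable flux integrand, then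
`W(y,k) = θ e(k)` is a finite-energy mild solution with `θL = θR = θ`, for any albedos: the
normalisation `p₋ + 𝔤 = 1` "so that `W ≡ T` is a stationary solution (thermal equilibrium)".
[cite: KomorowskiOlla2020, §1 (normalisation of the interface conditions)] -/
theorem isSlabSolution_equilibrium [SFinite M.μ] (αL αR : K → ℝ) (L θ : ℝ)
    (hdom : (fun k => θ * M.e k) ∈ M.dom)
    (hCe : ∀ᵐ k ∂M.μ, M.C (fun k' => θ * M.e k') k = 0)
    (hrefl : ∀ᵐ k ∂M.μ, M.e (M.refl k) = M.e k)
    (hint : Integrable (fun k => M.v k * M.w k * M.e k) M.μ) :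
    M.IsSlabSolution αL αR L θ θ (fun _ k => θ * M.e k) where
  mem_dom := fun _ _ => hdom
  collision_integrableOn := Eventually.of_forall fun k =>
    (continuous_const (y := M.C (fun k' => θ * M.e k') k)).integrableOn_Icc
  transport := by
    filter_upwards [hCe] with k hk
    intro y _
    simp [hk]
  left_wall := by
    filter_upwards [hrefl] with k hk
    intro _
    rw [hk]
    ring
  right_wall := by
    filter_upwards [hrefl] with k hk
    intro _
    rw [hk]
    ring
  flux_integrable := by
    intro y _
    have : (fun k => M.v k * M.w k * (θ * M.e k)) = fun k => θ * (M.v k * M.w k * M.e k) := by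
      ext k; ring
    rw [this]
    exact hint.const_mul θ
  exchange_integrable := by
    have hae : (fun p : ℝ × K => M.w p.2 * M.C (fun k' => θ * M.e k') p.2) =ᵐ[
        (volume.restrict (Icc 0 L)).prod M.μ] fun _ => 0 := by
      have h2 := (Measure.quasiMeasurePreserving_snd
        (μ := volume.restrict (Icc 0 L)) (ν := M.μ)).ae hCe
      filter_upwards [h2] with p hp
      simp [hp]
    exact (integrable_zero _ _ _).congr hae.symm

/-- A `KineticSlabConductance` statement is consistent with thermal equilibrium: for equal wall
temperatures it asks for zero flux, which the equilibrium profile has when `∫ v w e dμ = 0`.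
[folklore] -/
theorem energyFlux_equilibrium_eq_zero (θ y : ℝ)
    (hodd : ∫ k, M.v k * M.w k * M.e k ∂M.μ = 0) :
    M.energyFlux (fun _ k => θ * M.e k) y = 0 := by
  rw [energyFlux_equilibrium, hodd, mul_zero]

/-! ### Linearity: fluxes and superposition of solutions -/

/-- The energy flux is additive (given integrable flux integrands). [folklore] -/
theorem energyFlux_add {W₁ W₂ : ℝ → K → ℝ} {y : ℝ}
    (h₁ : Integrable (fun k => M.v k * M.w k * W₁ y k) M.μ)
    (h₂ : Integrable (fun k => M.v k * M.w k * W₂ y k) M.μ) :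
    M.energyFlux (fun y k => W₁ y k + W₂ y k) y = M.energyFlux W₁ y + M.energyFlux W₂ y := by
  unfold energyFlux
  rw [← integral_add h₁ h₂]
  congr 1
  ext k
  ring

/-- The energy flux is homogeneous. [folklore] -/
theorem energyFlux_smul (W : ℝ → K → ℝ) (c y : ℝ) :
    M.energyFlux (fun y k => c * W y k) y = c * M.energyFlux W y := by
  unfold energyFlux
  rw [← integral_const_mul]
  congr 1
  ext k
  ring

/-- **Superposition, sums.** If `dom` is closed under addition and `C` is additive on `dom`, the
sum of two finite-energy mild solutions is one, with added wall temperatures. [folklore] -/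
theorem IsSlabSolution.add [SFinite M.μ]
    (hdom : ∀ f ∈ M.dom, ∀ g ∈ M.dom, f + g ∈ M.dom)
    (hC : ∀ f ∈ M.dom, ∀ g ∈ M.dom, M.C (f + g) = M.C f + M.C g)
    {θL₁ θR₁ θL₂ θR₂ : ℝ} {W₁ W₂ : ℝ → K → ℝ}
    (h₁ : M.IsSlabSolution αL αR L θL₁ θR₁ W₁) (h₂ : M.IsSlabSolution αL αR L θL₂ θR₂ W₂) :
    M.IsSlabSolution αL αR L (θL₁ + θL₂) (θR₁ + θR₂) (fun y k => W₁ y k + W₂ y k) where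
  mem_dom y hy := hdom _ (h₁.mem_dom y hy) _ (h₂.mem_dom y hy)
  collision_integrableOn := by
    filter_upwards [h₁.collision_integrableOn, h₂.collision_integrableOn] with k hk₁ hk₂
    refine IntegrableOn.congr_fun (hk₁.add hk₂) (fun y hy => ?_) measurableSet_Icc
    show M.C (W₁ y) k + M.C (W₂ y) k = M.C (fun k => W₁ y k + W₂ y k) k
    have : (fun k => W₁ y k + W₂ y k) = W₁ y + W₂ y := rfl
    rw [this, hC _ (h₁.mem_dom y hy) _ (h₂.mem_dom y hy), Pi.add_apply]
  transport := by
    filter_upwards [h₁.transport, h₂.transport, h₁.collision_integrableOn,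
      h₂.collision_integrableOn] with k hk₁ hk₂ hi₁ hi₂
    intro y hy
    have hsub : Icc 0 y ⊆ Icc 0 L := Icc_subset_Icc le_rfl hy.2
    have hI₁ : IntervalIntegrable (fun s => M.C (W₁ s) k) volume 0 y :=
      (hi₁.mono_set (by rw [uIcc_of_le hy.1]; exact hsub)).intervalIntegrable
    have hI₂ : IntervalIntegrable (fun s => M.C (W₂ s) k) volume 0 y :=
      (hi₂.mono_set (by rw [uIcc_of_le hy.1]; exact hsub)).intervalIntegrable
    have heq : ∫ s in (0 : ℝ)..y, M.C (fun k => W₁ s k + W₂ s k) k =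
        ∫ s in (0 : ℝ)..y, (M.C (W₁ s) k + M.C (W₂ s) k) := by
      apply intervalIntegral.integral_congr
      intro s hs
      rw [uIcc_of_le hy.1] at hs
      show M.C (fun k => W₁ s k + W₂ s k) k = M.C (W₁ s) k + M.C (W₂ s) k
      have : (fun k => W₁ s k + W₂ s k) = W₁ s + W₂ s := rfl
      rw [this, hC _ (h₁.mem_dom s (hsub hs)) _ (h₂.mem_dom s (hsub hs)), Pi.add_apply]
    rw [heq, intervalIntegral.integral_add hI₁ hI₂, ← hk₁ y hy, ← hk₂ y hy]
    ring
  left_wall := by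
    filter_upwards [h₁.left_wall, h₂.left_wall] with k hk₁ hk₂
    intro hv
    rw [hk₁ hv, hk₂ hv]
    ring
  right_wall := by
    filter_upwards [h₁.right_wall, h₂.right_wall] with k hk₁ hk₂
    intro hv
    rw [hk₁ hv, hk₂ hv]
    ring
  flux_integrable y hy := by
    have : (fun k => M.v k * M.w k * (W₁ y k + W₂ y k)) =
        fun k => M.v k * M.w k * W₁ y k + M.v k * M.w k * W₂ y k := by
      ext k
      ring
    rw [this]
    exact (h₁.flux_integrable y hy).add (h₂.flux_integrable y hy)
  exchange_integrable := by
    have hmem : ∀ᵐ p ∂((volume.restrict (Icc 0 L)).prod M.μ), p.1 ∈ Icc (0 : ℝ) L :=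
      (Measure.quasiMeasurePreserving_fst (μ := volume.restrict (Icc 0 L)) (ν := M.μ)).ae
        (ae_restrict_mem measurableSet_Icc)
    refine (h₁.exchange_integrable.add h₂.exchange_integrable).congr ?_
    filter_upwards [hmem] with p hp
    show M.w p.2 * M.C (W₁ p.1) p.2 + M.w p.2 * M.C (W₂ p.1) p.2 =
      M.w p.2 * M.C (fun k => W₁ p.1 k + W₂ p.1 k) p.2
    have : (fun k => W₁ p.1 k + W₂ p.1 k) = W₁ p.1 + W₂ p.1 := rfl
    rw [this, hC _ (h₁.mem_dom _ hp) _ (h₂.mem_dom _ hp), Pi.add_apply]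
    ring

/-- **Superposition, scalar multiples.** If `dom` is closed under scalars and `C` is homogeneous
on `dom`, scalar multiples of finite-energy mild solutions are solutions, with scaled wall
temperatures. [folklore] -/
theorem IsSlabSolution.smul [SFinite M.μ]
    (hdom : ∀ (c : ℝ), ∀ f ∈ M.dom, c • f ∈ M.dom)
    (hC : ∀ (c : ℝ), ∀ f ∈ M.dom, M.C (c • f) = c • M.C f)
    (h : M.IsSlabSolution αL αR L θL θR W) (c : ℝ) :
    M.IsSlabSolution αL αR L (c * θL) (c * θR) (fun y k => c * W y k) where
  mem_dom y hy := by
    show c • W y ∈ M.dom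
    exact hdom c _ (h.mem_dom y hy)
  collision_integrableOn := by
    filter_upwards [h.collision_integrableOn] with k hk
    refine IntegrableOn.congr_fun (hk.const_mul c) (fun y hy => ?_) measurableSet_Icc
    show c * M.C (W y) k = M.C (fun k => c * W y k) k
    have : (fun k => c * W y k) = c • W y := rfl
    rw [this, hC c _ (h.mem_dom y hy), Pi.smul_apply, smul_eq_mul]
  transport := by
    filter_upwards [h.transport] with k hk
    intro y hy
    have hsub : Icc 0 y ⊆ Icc 0 L := Icc_subset_Icc le_rfl hy.2
    have heq : ∫ s in (0 : ℝ)..y, M.C (fun k => c * W s k) k =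
        ∫ s in (0 : ℝ)..y, c * M.C (W s) k := by
      apply intervalIntegral.integral_congr
      intro s hs
      rw [uIcc_of_le hy.1] at hs
      show M.C (fun k => c * W s k) k = c * M.C (W s) k
      have : (fun k => c * W s k) = c • W s := rfl
      rw [this, hC c _ (h.mem_dom s (hsub hs)), Pi.smul_apply, smul_eq_mul]
    rw [heq, intervalIntegral.integral_const_mul, ← hk y hy]
    ring
  left_wall := by
    filter_upwards [h.left_wall] with k hk
    intro hv
    rw [hk hv]
    ring
  right_wall := by
    filter_upwards [h.right_wall] with k hk
    intro hv
    rw [hk hv]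
    ring
  flux_integrable y hy := by
    have : (fun k => M.v k * M.w k * (c * W y k)) = fun k => c * (M.v k * M.w k * W y k) := by
      ext k
      ring
    rw [this]
    exact (h.flux_integrable y hy).const_mul c
  exchange_integrable := by
    have hmem : ∀ᵐ p ∂((volume.restrict (Icc 0 L)).prod M.μ), p.1 ∈ Icc (0 : ℝ) L :=
      (Measure.quasiMeasurePreserving_fst (μ := volume.restrict (Icc 0 L)) (ν := M.μ)).ae
        (ae_restrict_mem measurableSet_Icc)
    refine (h.exchange_integrable.const_mul c).congr ?_
    filter_upwards [hmem] with p hp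
    show c * (M.w p.2 * M.C (W p.1) p.2) = M.w p.2 * M.C (fun k => c * W p.1 k) p.2
    have : (fun k => c * W p.1 k) = c • W p.1 := rfl
    rw [this, hC c _ (h.mem_dom _ hp), Pi.smul_apply, smul_eq_mul]
    ring

/-- **Reduction to the homogeneous and the unit problem.** Let `C` be linear on the subspace
`dom`, which contains the equilibrium profile `e`; let `e` be a reflection-invariant collision
invariant (`C e = 0`) with an integrable, mean-zero flux integrand (`∫ v w e dμ = 0`). If every
solution of the HOMOGENEOUS problem (`θL = θR = 0`: cold walls) has zero flux, and ONE solution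
`W₁` of the UNIT problem (`θL = 1`, `θR = 0`) has flux `G` at every height, then `G` is the
kinetic slab conductance: any solution `W` with temperatures `θL, θR` differs from
`θR • e + (θL - θR) • W₁` by a homogeneous solution. [folklore] -/
theorem kineticSlabConductance_of_homogeneous [SFinite M.μ]
    (hdom_add : ∀ f ∈ M.dom, ∀ g ∈ M.dom, f + g ∈ M.dom)
    (hdom_smul : ∀ (c : ℝ), ∀ f ∈ M.dom, c • f ∈ M.dom)
    (hC_add : ∀ f ∈ M.dom, ∀ g ∈ M.dom, M.C (f + g) = M.C f + M.C g)
    (hC_smul : ∀ (c : ℝ), ∀ f ∈ M.dom, M.C (c • f) = c • M.C f)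
    (he_dom : M.e ∈ M.dom) (hCe : ∀ᵐ k ∂M.μ, M.C M.e k = 0)
    (hrefl : ∀ᵐ k ∂M.μ, M.e (M.refl k) = M.e k)
    (hint : Integrable (fun k => M.v k * M.w k * M.e k) M.μ)
    (hodd : ∫ k, M.v k * M.w k * M.e k ∂M.μ = 0)
    (hhom : ∀ W : ℝ → K → ℝ, M.IsSlabSolution αL αR L 0 0 W → ∀ y ∈ Icc 0 L, M.energyFlux W y = 0)
    {W₁ : ℝ → K → ℝ} (h₁ : M.IsSlabSolution αL αR L 1 0 W₁) {G : ℝ}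
    (hG : ∀ y ∈ Icc 0 L, M.energyFlux W₁ y = G) :
    KineticSlabConductance M αL αR L G := by
  intro θL θR W hW y hy
  -- the equilibrium at the right wall temperature
  have hCe' : ∀ᵐ k ∂M.μ, M.C (fun k' => θR * M.e k') k = 0 := by
    filter_upwards [hCe] with k hk
    have : (fun k' => θR * M.e k') = θR • M.e := rfl
    rw [this, hC_smul θR _ he_dom, Pi.smul_apply, hk, smul_zero]
  have heq : M.IsSlabSolution αL αR L θR θR (fun _ k => θR * M.e k) :=
    M.isSlabSolution_equilibrium αL αR L θR (hdom_smul θR _ he_dom) hCe' hrefl hint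
  -- subtract it and `(θL - θR) • W₁`: a homogeneous solution
  have hcomb := (hW.add M hdom_add hC_add ((heq.smul M hdom_smul hC_smul (-1)).add M hdom_add
    hC_add (h₁.smul M hdom_smul hC_smul (-(θL - θR)))))
  have ha : θL + (-1 * θR + -(θL - θR) * 1) = 0 := by ring
  have hb : θR + (-1 * θR + -(θL - θR) * 0) = 0 := by ring
  rw [ha, hb] at hcomb
  have hzero := hhom _ hcomb y hy
  -- fluxes of the three pieces
  have hfW := hW.flux_integrable y hy
  have hfe := (heq.smul M hdom_smul hC_smul (-1)).flux_integrable y hy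
  have hf₁ := (h₁.smul M hdom_smul hC_smul (-(θL - θR))).flux_integrable y hy
  have hfsum := ((heq.smul M hdom_smul hC_smul (-1)).add M hdom_add hC_add
    (h₁.smul M hdom_smul hC_smul (-(θL - θR)))).flux_integrable y hy
  rw [M.energyFlux_add hfW hfsum, M.energyFlux_add hfe hf₁,
    M.energyFlux_smul (fun _ k => θR * M.e k) (-1) y, M.energyFlux_smul W₁ (-(θL - θR)) y,
    M.energyFlux_equilibrium_eq_zero θR y hodd, hG y hy] at hzero
  linarith

end KineticMedium

/-! ### Uniqueness of the conductance and the bridge to `slabConductance` -/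

namespace KineticSlabConductance

variable {M : KineticMedium K} {αL αR : K → ℝ} {L G G' : ℝ}

/-- The conductance is unique as soon as one solution with distinct wall temperatures exists.
[folklore] -/
theorem unique (hG : KineticSlabConductance M αL αR L G) (hG' : KineticSlabConductance M αL αR L G')
    (hL : 0 ≤ L)
    (hex : ∃ (θL θR : ℝ) (W : ℝ → K → ℝ), θL ≠ θR ∧ M.IsSlabSolution αL αR L θL θR W) :
    G = G' := by
  obtain ⟨θL, θR, W, hne, hW⟩ := hex
  have h1 := hG hW 0 ⟨le_rfl, hL⟩
  have h2 := hG' hW 0 ⟨le_rfl, hL⟩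
  rw [h1] at h2
  exact mul_right_cancel₀ (sub_ne_zero.2 hne) h2

/-- Scaling out the temperature difference: with conductance `G`, a solution with
`θL - θR = 1` has flux exactly `G`. [folklore] -/
theorem energyFlux_eq (hG : KineticSlabConductance M αL αR L G) {θL θR : ℝ} {W : ℝ → K → ℝ}
    (hW : M.IsSlabSolution αL αR L θL θR W) (hθ : θL - θR = 1) {y : ℝ} (hy : y ∈ Icc 0 L) :
    M.energyFlux W y = G := by
  rw [hG hW y hy, hθ, mul_one]

end KineticSlabConductance

/-- **Bridge.** If some `G` is a kinetic slab conductance and a solution with distinct wall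
temperatures exists, then the number `M.slabConductance αL αR L` is a kinetic slab conductance
(and is that `G`, by `KineticSlabConductance.unique`). [folklore] -/
theorem kineticSlabConductance_slabConductance {M : KineticMedium K} {αL αR : K → ℝ} {L : ℝ}
    (hL : 0 ≤ L) (hex : ∃ G, KineticSlabConductance M αL αR L G)
    (hsol : ∃ (θL θR : ℝ) (W : ℝ → K → ℝ), θL ≠ θR ∧ M.IsSlabSolution αL αR L θL θR W) :
    KineticSlabConductance M αL αR L (M.slabConductance αL αR L) := by
  classical
  obtain ⟨G, hG⟩ := hex
  have hu : ∃! G : ℝ, KineticSlabConductance M αL αR L G :=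
    ⟨G, hG, fun G' hG' => hG'.unique hG hL hsol⟩
  unfold KineticMedium.slabConductance
  rw [dif_pos hu]
  exact hu.choose_spec.1

/-- With the bridge, the number is the given conductance. [folklore] -/
theorem slabConductance_eq {M : KineticMedium K} {αL αR : K → ℝ} {L G : ℝ}
    (hL : 0 ≤ L) (hG : KineticSlabConductance M αL αR L G)
    (hsol : ∃ (θL θR : ℝ) (W : ℝ → K → ℝ), θL ≠ θR ∧ M.IsSlabSolution αL αR L θL θR W) :
    M.slabConductance αL αR L = G :=
  (kineticSlabConductance_slabConductance hL ⟨G, hG⟩ hsol).unique hG hL hsol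

/-! ### Worked special case: the collisionless two-stream slab between grey walls

The forward/backward two-stream medium (velocities `±1`, no collisions, reflection swaps the two
streams, `e = w = 1`) between walls of constant albedos `αL, αR`: the slab problem is solved in
closed form and EVERY finite-energy mild solution carries the flux
`(θL - θR) / (1/αL + 1/αR - 1)` — the classical exchange factor `1/(1/ε₁ + 1/ε₂ - 1)` of two
infinite parallel grey planes (Christiansen/Hottel), `= α/(2 - α)` for equal albedos, the
integrand of the Landauer two-grey-wall formula. This checks the sign and normalisation
conventions of `KineticSlabConductance` and shows the notion is not vacuous. -/

/-- The **two-stream collisionless medium** on `K = Bool` (`true` = right-movers): counting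
measure, `v = ±1`, `C = 0` with domain everything, reflection `not`, `e = w = 1`. [folklore] -/
def twoStreamMedium : KineticMedium Bool where
  μ := Measure.dirac true + Measure.dirac false
  v := fun b => if b then 1 else -1
  C := fun _ _ => 0
  dom := Set.univ
  refl := fun b => !b
  e := fun _ => 1
  w := fun _ => 1

namespace twoStreamMedium

/-- The energy flux in the two-stream medium is `W(y, →) - W(y, ←)`. [folklore] -/
theorem energyFlux_eq (W : ℝ → Bool → ℝ) (y : ℝ) :
    twoStreamMedium.energyFlux W y = W y true - W y false := by
  unfold KineticMedium.energyFlux twoStreamMedium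
  simp only
  rw [integral_add_measure Integrable.of_finite Integrable.of_finite, integral_dirac,
    integral_dirac]
  simp only [if_true, one_mul, Bool.false_eq_true, if_false, neg_mul]
  ring

/-- **Existence.** With `D = αL + αR - αL αR ≠ 0`, the `y`-independent profile
`W(→) = (θL αL + (1 - αL) θR αR)/D`, `W(←) = (θR αR + (1 - αR) θL αL)/D` is a finite-energy mild
solution of the two-stream slab problem, for every length `L`. [folklore] -/
theorem isSlabSolution (αL αR L θL θR : ℝ) (hD : αL + αR - αL * αR ≠ 0) :
    twoStreamMedium.IsSlabSolution (fun _ => αL) (fun _ => αR) L θL θR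
      (fun _ b => if b then (θL * αL + (1 - αL) * (θR * αR)) / (αL + αR - αL * αR)
        else (θR * αR + (1 - αR) * (θL * αL)) / (αL + αR - αL * αR)) where
  mem_dom := fun _ _ => Set.mem_univ _
  collision_integrableOn := Eventually.of_forall fun k => by
    simp only [twoStreamMedium]
    exact integrableOn_zero
  transport := Eventually.of_forall fun k => by
    intro y _
    simp [twoStreamMedium]
  left_wall := by
    simp only [twoStreamMedium, ae_add_measure_iff, ae_dirac_eq, Filter.eventually_pure]
    refine ⟨fun _ => ?_, fun h => ?_⟩
    · simp only [if_true, Bool.not_true, Bool.false_eq_true, if_false, mul_one]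
      have hY := div_mul_cancel₀ (θR * αR + (1 - αR) * (θL * αL)) hD
      rw [div_eq_iff hD]
      linear_combination (αL - 1) * hY
    · simp at h
      linarith
  right_wall := by
    simp only [twoStreamMedium, ae_add_measure_iff, ae_dirac_eq, Filter.eventually_pure]
    refine ⟨fun h => ?_, fun _ => ?_⟩
    · simp at h
      linarith
    · simp only [Bool.false_eq_true, if_false, Bool.not_false, if_true, mul_one]
      have hY := div_mul_cancel₀ (θL * αL + (1 - αL) * (θR * αR)) hD
      rw [div_eq_iff hD]
      linear_combination (αR - 1) * hY
  flux_integrable := fun _ _ => by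
    simp only [twoStreamMedium]
    exact (Integrable.of_finite (μ := Measure.dirac true)).add_measure Integrable.of_finite
  exchange_integrable := by
    simp only [twoStreamMedium, mul_zero]
    exact integrable_zero _ _ _

/-- **The two-grey-wall law.** For constant albedos with `αL + αR - αL αR ≠ 0` and `0 ≤ L`,
every finite-energy mild solution of the collisionless two-stream slab has flux
`αL αR (θL - θR)/(αL + αR - αL αR) = (θL - θR)/(1/αL + 1/αR - 1)`: the conductance is the
exchange factor of two infinite parallel grey planes (specular or diffuse reflection alike in one
dimension), `α/(2 - α)` for equal albedos. Proof: no collisions make each stream constant in `y`;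
the two wall laws are then two linear equations for the two stream values.
[cite: GranetAlvaradoBluestein2020, Table 11.4 case 1 and note a] -/
theorem kineticSlabConductance (αL αR L : ℝ) (hD : αL + αR - αL * αR ≠ 0) (hL : 0 ≤ L) :
    KineticSlabConductance twoStreamMedium (fun _ => αL) (fun _ => αR) L
      (αL * αR / (αL + αR - αL * αR)) := by
  intro θL θR W hW y hy
  have hL' : L ∈ Icc 0 L := ⟨hL, le_rfl⟩
  have htr := hW.transport
  have hlw := hW.left_wall
  have hrw := hW.right_wall
  simp only [twoStreamMedium, ae_add_measure_iff] at htr hlw hrw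
  simp only [ae_dirac_eq, Filter.eventually_pure] at htr hlw hrw
  obtain ⟨htr1, htr2⟩ := htr
  have e1 := htr1 y hy
  have e2 := htr2 y hy
  have e3 := htr1 L hL'
  have e4 := htr2 L hL'
  have w1 := hlw.1 (by norm_num)
  have w2 := hrw.2 (by norm_num)
  simp at e1 e2 e3 e4 w1 w2
  have ha : W y true = W 0 true := by linarith
  have hb : W y false = W 0 false := by linarith
  have hc : W L true = W 0 true := by linarith
  have hd : W L false = W 0 false := by linarith
  rw [hc, hd] at w2
  rw [energyFlux_eq, ha, hb, div_mul_eq_mul_div, eq_div_iff hD]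
  linear_combination αR * w1 - αL * w2

/-- Equal albedos: the Landauer two-grey-wall value `α/(2 - α)`. [folklore] -/
theorem kineticSlabConductance_of_eq (α L : ℝ) (hα : 2 - α ≠ 0) (hα0 : α ≠ 0) (hL : 0 ≤ L) :
    KineticSlabConductance twoStreamMedium (fun _ => α) (fun _ => α) L (α / (2 - α)) := by
  have hD : α + α - α * α ≠ 0 := by
    have : α + α - α * α = α * (2 - α) := by ring
    rw [this]
    exact mul_ne_zero hα0 hα
  have h := kineticSlabConductance α α L hD hL
  have hval : α * α / (α + α - α * α) = α / (2 - α) := by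
    rw [div_eq_div_iff hD hα]
    ring
  rwa [hval] at h

end twoStreamMedium

end Literature.MathematicalPhysics.KineticTheory
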